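import Mathlib
import HarnessLib
import Summits.ValiantsHypothesis.ValiantsHypothesis.Theorems.EquivariantDialLayersStabilisers
import Summits.ValiantsHypothesis.ValiantsHypothesis.Theorems.EquivariantDialLayersSquare
import Literature.RepresentationTheory.FiniteGroups.SymmetricGroupPieriRule

/-!
# Equivariant dial layers: the type list of the quadrics `R_2` under `𝔖_m × 𝔖_m` ([I2])

`R = ℂ[x_{ij} : i, j < m]`, `G = 𝔖_m × 𝔖_m` acting by `x_{ij} ↦ x_{σ i, τ j}`.  For an irreducible character
`χ = χ^λ ⊠ χ^μ` of `G` write `Q_χ v = ∑_{(g,h) ∈ G} χ^λ(g) χ^μ(h) · (g,h)⁻¹ · v` for the (unnormalised)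
`χ`-symmetriser of a quadric `v ∈ R_2`.

**Theorem [I2] (type list).**  If `λ` or `μ` has MORE THAN TWO CELLS BELOW ITS FIRST ROW
(`|λ| > λ₁ + 2` or `|μ| > μ₁ + 2`) then `Q_{χ^λ ⊠ χ^μ} v = 0` for every quadric `v` (`m ≥ 2`)
(`sum_boxProd_smul_rename_eq_zero`).  Hence the isotypic types of `R_2` are among the sixteen
`λ ⊠ μ`, `λ, μ ∈ {(m), (m-1,1), (m-2,2), (m-2,1,1)}`.

Proof.  A monomial quadric `x_{ab} x_{cd}` is fixed by `N = K × K'`, `K ≅ 𝔖_{m-2}` the pointwise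
stabiliser of two letters `⊇ {a, c}` and `K'` that of two letters `⊇ {b, d}` (§1).  The isotypic projector
`P_χ` maps `N`-fixed vectors into `V_χ ∩ V^N`, which is `0` as soon as `∑_{n ∈ N} χ(n) = 0`
(`IsotypicComponents`, §3 here).  Now `∑_N χ^λ ⊠ χ^μ = (∑_K χ^λ)(∑_{K'} χ^μ)`, and by Pieri's rule
(`SymmetricGroupPieriRule`: `∑_{ρ ∈ 𝔖_b} χ^λ(e(σ ⊔ ρ)e⁻¹) = b! ∑_{λ/π' horizontal strip} χ^{π'}(σ)`,
the two-point-stabiliser case of Young's rule, James–Liebeck 29.13) a non-zero factor forces a partition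
`π' ⊢ 2` interlaced by `λ`, whence `|λ| - λ₁ ≤ |π'| = 2` (§2).  Linearity in `v` finishes (§4).

What this file does NOT do: it says nothing about which of the sixteen types occur, nothing about
multiplicities, and nothing about `VP ≠ VNP`, the cell `EqHardBiPerm` or the leaf `IdealWidthSuperpoly`;
it is the type-list ingredient of the first superlinear degree-2 rung (`EquivariantDialLayersSuperlinear`).
On paper `𝔠 ∩ R_2` (the cheap ideal of `EquivariantDialLayersBlockWitness`) is strictly LARGER than the
cheap isotypic component; only the inclusion "cheap types `⊆ 𝔠`" is ever used downstream.

References: [cite: JamesLiebeck2001, 29.13 (Young's rule for two-point stabilisers)];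
[cite: JamesKerber1981, 2.3]; [cite: SerreLinearRepresentations1977, §2.6 Thm. 8];
the kernel inputs are `sum_spechtCharacter_permCongr_sumCongr` (Pieri), `isotypicProj_apply_mem_invariants`
and `range_isotypicProj_inf_invariants_eq_bot_of_sum_eq_zero` (isotypic components of invariants).
-/

set_option linter.dupNamespace false

namespace Summit.ValiantsHypothesis.ValiantsHypothesis.Theorems.EquivariantDialLayersQuadricTypes

open MvPolynomial
open Equiv (Perm)
open Literature.RepresentationTheory.FiniteGroups Literature.NumberTheory.DiophantineGeometry
open Summit.ValiantsHypothesis.ValiantsHypothesis.Theorems.EquivariantDialLayersBlockWitness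
open Summit.ValiantsHypothesis.ValiantsHypothesis.Theorems.EquivariantDialLayersSymmetrisers

variable {m : ℕ}

/-! ### §1 Two pinned letters: a splitting `[2] ⊔ [m-2] ≃ [m]` whose `𝔖_{m-2}` fixes them -/

/-- For any two letters `a, c` (`m ≥ 2`) there is a splitting `e : [2] ⊔ [m-2] ≃ [m]` such that every
`e (1 ⊔ ρ) e⁻¹`, `ρ ∈ 𝔖_{m-2}`, fixes `a` and `c`. [folklore] -/
theorem exists_splitting_fixing (hm : 2 ≤ m) (a c : Fin m) :
    ∃ e : Fin 2 ⊕ Fin (m - 2) ≃ Fin m, ∀ ρ : Perm (Fin (m - 2)),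
      e.permCongr ((1 : Perm (Fin 2)).sumCongr ρ) a = a ∧ e.permCongr ((1 : Perm (Fin 2)).sumCongr ρ) c = c := by
  classical
  -- a second pinned letter `c' ≠ a` with `c ∈ {a, c'}`
  obtain ⟨c', hc'a, hcc'⟩ : ∃ c' : Fin m, c' ≠ a ∧ (c = a ∨ c = c') := by
    by_cases hca : c = a
    · obtain ⟨x, hx⟩ : ∃ x : Fin m, x ≠ a := by
        by_contra hall
        push Not at hall
        have h1 : Fintype.card (Fin m) ≤ 1 :=
          Fintype.card_le_one_iff.2 fun x y => (hall x).trans (hall y).symm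
        rw [Fintype.card_fin] at h1
        omega
      exact ⟨x, hx, Or.inl hca⟩
    · exact ⟨c, hca, Or.inr rfl⟩
  set S : Finset (Fin m) := {a, c'} with hSdef
  have hS2 : Fintype.card {x // x ∈ S} = 2 := by
    rw [Fintype.card_coe, hSdef]
    exact Finset.card_pair hc'a.symm
  have hSc : Fintype.card {x // ¬ x ∈ S} = m - 2 := by
    rw [Fintype.card_subtype_compl, Fintype.card_fin, hS2]
  refine ⟨((Fintype.equivFinOfCardEq hS2).symm.sumCongr (Fintype.equivFinOfCardEq hSc).symm).trans
    (Equiv.sumCompl fun x => x ∈ S), fun ρ => ?_⟩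
  have key : ∀ x, x ∈ S →
      (((Fintype.equivFinOfCardEq hS2).symm.sumCongr (Fintype.equivFinOfCardEq hSc).symm).trans
        (Equiv.sumCompl fun x => x ∈ S)).permCongr ((1 : Perm (Fin 2)).sumCongr ρ) x = x := by
    intro x hx
    simp [Equiv.permCongr_apply, Equiv.sumCompl_symm_apply_of_pos hx]
  have ha : a ∈ S := by simp [hSdef]
  have hc : c ∈ S := by rcases hcc' with rfl | rfl <;> simp [hSdef]
  exact ⟨key a ha, key c hc⟩

/-! ### §2 Pieri: `∑_{ρ ∈ 𝔖_{m-2}} χ^λ(e (1 ⊔ ρ) e⁻¹) ≠ 0` forces `λ₁ ≥ m - 2` -/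

/-- `ℓ(μ) ≤ |μ|`. [folklore] -/
theorem card_parts_le_size' (μ : Nat.Partition m) : μ.parts.card ≤ m := by
  have h := Multiset.card_nsmul_le_sum (s := μ.parts) (a := 1) (fun x hx => μ.parts_pos hx)
  rw [μ.parts_sum] at h
  simpa using h

/-- If the sum of `χ^λ` over a Young subgroup `1 × 𝔖_b ≤ 𝔖_2 × 𝔖_b ≤ 𝔖_m` is non-zero then `λ` has at most two
cells below its first row (`λ ∈ {(m), (m-1,1), (m-2,2), (m-2,1,1)}`): by Pieri's rule the sum is
`b! · ∑_{π' ⊢ 2, λ/π' horizontal strip} f^{π'}`, and `λ ↦ π'` forces `|λ| - λ₁ ≤ |π'| = 2`.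
[cite: JamesLiebeck2001, 29.13 (Young's rule for a two-point stabiliser; James–Kerber 2.3)] -/
theorem le_getD_add_two_of_sum_ne_zero {b : ℕ} (e : Fin 2 ⊕ Fin b ≃ Fin m) (la : Nat.Partition m)
    (h : ∑ ρ : Perm (Fin b), spechtCharacter ℂ la (e.permCongr ((1 : Perm (Fin 2)).sumCongr ρ)) ≠ 0) :
    m ≤ la.sortedParts.getD 0 0 + 2 := by
  classical
  have hbm : 2 + b = m := by
    have := Fintype.card_congr e
    simpa using this
  rw [sum_spechtCharacter_permCongr_sumCongr e la 1] at h
  obtain ⟨π', hπ', -⟩ := Finset.exists_ne_zero_of_sum_ne_zero (right_ne_zero_of_mul h)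
  have hint := (Finset.mem_filter.1 hπ').2
  -- sum the interlacing inequalities `λ_{i+1} ≤ π'_i` over `i < m`
  have hla : ∑ i : Fin (m + 1), la.sortedParts.getD i 0 = m :=
    sum_getD_sortedParts la ((card_parts_le_size' la).trans (Nat.le_succ m))
  have hπ : ∑ i : Fin m, π'.sortedParts.getD i 0 = 2 :=
    sum_getD_sortedParts π' ((card_parts_le_size' π').trans (by omega))
  rw [Fin.sum_univ_succ] at hla
  simp only [Fin.val_zero, Fin.val_succ] at hla
  have hle : ∑ i : Fin m, la.sortedParts.getD (i + 1) 0 ≤ ∑ i : Fin m, π'.sortedParts.getD i 0 :=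
    Finset.sum_le_sum fun i _ => (hint i).2
  omega

/-! ### §3 Isotypic components without fixed vectors -/

/-- If `∑_{n ∈ N} χ(n) = 0` then `P_χ` kills every `N`-fixed vector (`P_χ v ∈ V_χ ∩ V^N = 0`).
[cite: SerreLinearRepresentations1977, §2.6 Thm. 8 (with Lange–Rodriguez 2022, §2.9.2 (2.34))] -/
theorem isotypicProj_eq_zero_of_sum_eq_zero {G V : Type} [Group G] [Fintype G] [AddCommGroup V] [Module ℂ V]
    [FiniteDimensional ℂ V] (ρ : Representation ℂ G V) (N : Subgroup G) [Fintype N] {χ : G → ℂ}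
    (hχ : IsIrrChar G χ) (h0 : ∑ n : N, χ n = 0) {v : V} (hv : ∀ n ∈ N, ρ n v = v) :
    isotypicProj ρ χ v = 0 := by
  have hvN : v ∈ Representation.invariants (ρ.comp N.subtype) := by
    rw [Representation.mem_invariants]
    intro n
    exact hv n n.2
  have hP : isotypicProj ρ χ v ∈
      LinearMap.range (isotypicProj ρ χ) ⊓ Representation.invariants (ρ.comp N.subtype) :=
    Submodule.mem_inf.2 ⟨LinearMap.mem_range_self _ _,
      isotypicProj_apply_mem_invariants ρ N hχ.isCharacter.isClassFun hvN⟩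
  rw [range_isotypicProj_inf_invariants_eq_bot_of_sum_eq_zero ρ hχ h0] at hP
  exact (Submodule.mem_bot ℂ).1 hP

/-! ### §4 The vanishing of the non-listed box-product symmetrisers on quadrics -/

/-- Scalar packaging: `∑_t (C · a t) • F t = C • ∑_t a t • F t`. [folklore] -/
theorem sum_mul_smul_eq {ι M : Type*} [Fintype ι] [AddCommGroup M] [Module ℂ M] (C : ℂ) (a : ι → ℂ) (F : ι → M) :
    ∑ t, (C * a t) • F t = C • ∑ t, a t • F t := by
  rw [Finset.smul_sum]
  exact Finset.sum_congr rfl fun t _ => by rw [smul_smul]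

/-- ★ For `λ` or `μ` with more than two cells below the first row, the `χ^λ ⊠ χ^μ`-weighted symmetriser kills
every product `x_p x_q` (`m ≥ 2`): `x_p x_q` is fixed by `K × K'` with `K, K' ≅ 𝔖_{m-2}` two-letter
stabilisers, and `∑_{K} χ^λ · ∑_{K'} χ^μ = 0` by §2. [this file] -/
theorem sum_boxProd_smul_rename_X_mul_X_eq_zero (hm : 2 ≤ m) {la mu : Nat.Partition m}
    (h : ¬ (m ≤ la.sortedParts.getD 0 0 + 2 ∧ m ≤ mu.sortedParts.getD 0 0 + 2)) (p q : Fin m × Fin m) :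
    ∑ t : Perm (Fin m) × Perm (Fin m), (spechtCharacter ℂ la t.1 * spechtCharacter ℂ mu t.2) •
      rename (Equiv.prodCongr t.1⁻¹ t.2⁻¹) (X p * X q : MvPolynomial (Fin m × Fin m) ℂ) = 0 := by
  classical
  obtain ⟨a, b⟩ := p
  obtain ⟨c, d⟩ := q
  -- the finite-dimensional `𝔖_m × 𝔖_m`-module `V₂` spanned by the products of two variables
  set V₂ : Submodule ℂ (MvPolynomial (Fin m × Fin m) ℂ) :=
    Submodule.span ℂ (Set.range fun pq : (Fin m × Fin m) × (Fin m × Fin m) => X pq.1 * X pq.2)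
  haveI : FiniteDimensional ℂ V₂ := FiniteDimensional.span_of_finite ℂ (Set.finite_range _)
  have hV : ∀ (g : Perm (Fin m) × Perm (Fin m)) (w : MvPolynomial (Fin m × Fin m) ℂ),
      w ∈ V₂ → (rename (Equiv.prodCongr g.1 g.2)).toLinearMap w ∈ V₂ := fun g w hw =>
    (Submodule.map_span_le _ _ _).2 (by
      rintro _ ⟨pq, rfl⟩
      rw [AlgHom.toLinearMap_apply, map_mul, rename_X, rename_X]
      exact Submodule.subset_span ⟨(_, _), rfl⟩) (Submodule.mem_map_of_mem hw)
  have hcomp : ∀ g g' : Perm (Fin m) × Perm (Fin m), (⇑(Equiv.prodCongr g.1 g.2) ∘ ⇑(Equiv.prodCongr g'.1 g'.2) :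
      Fin m × Fin m → Fin m × Fin m) = ⇑(Equiv.prodCongr (g * g').1 (g * g').2) :=
    fun g g' => funext fun ⟨i, j⟩ => rfl
  have hid : (⇑(Equiv.prodCongr (1 : Perm (Fin m) × Perm (Fin m)).1 (1 : Perm (Fin m) × Perm (Fin m)).2) :
      Fin m × Fin m → Fin m × Fin m) = id := funext fun ⟨i, j⟩ => rfl
  let ρ : Representation ℂ (Perm (Fin m) × Perm (Fin m)) V₂ :=
    { toFun := fun g => ((rename (Equiv.prodCongr g.1 g.2)).toLinearMap).restrict (hV g)
      map_one' := LinearMap.ext fun w => Subtype.ext (by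
        simp only [LinearMap.coe_restrict_apply, AlgHom.toLinearMap_apply, Module.End.one_apply, hid, rename_id_apply])
      map_mul' := fun g g' => LinearMap.ext fun w => Subtype.ext (by
        simp only [LinearMap.coe_restrict_apply, AlgHom.toLinearMap_apply, Module.End.mul_apply, rename_rename, hcomp]) }
  have hρ : ∀ (g : Perm (Fin m) × Perm (Fin m)) (x : V₂), ((ρ g x : V₂) : MvPolynomial (Fin m × Fin m) ℂ) =
      rename (Equiv.prodCongr g.1 g.2) (x : MvPolynomial (Fin m × Fin m) ℂ) := fun _ _ => rfl
  -- the vector `u = x_{ab} x_{cd}`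
  have hu : (X (a, b) * X (c, d) : MvPolynomial (Fin m × Fin m) ℂ) ∈ V₂ :=
    Submodule.subset_span ⟨((a, b), (c, d)), rfl⟩
  -- two splittings pinning the row letters `a, c` and the column letters `b, d`
  obtain ⟨e, he⟩ := exists_splitting_fixing hm a c
  obtain ⟨e', he'⟩ := exists_splitting_fixing hm b d
  -- the subgroup `N = Φ(𝔖_{m-2} × 𝔖_{m-2})`, `Φ = (e (1 ⊔ ·) e⁻¹) × (e' (1 ⊔ ·) e'⁻¹)`
  let φ : Perm (Fin (m - 2)) →* Perm (Fin m) :=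
    e.permCongrHom.toMonoidHom.comp ((Equiv.Perm.sumCongrHom (Fin 2) (Fin (m - 2))).comp
      (MonoidHom.inr (Perm (Fin 2)) (Perm (Fin (m - 2)))))
  let φ' : Perm (Fin (m - 2)) →* Perm (Fin m) :=
    e'.permCongrHom.toMonoidHom.comp ((Equiv.Perm.sumCongrHom (Fin 2) (Fin (m - 2))).comp
      (MonoidHom.inr (Perm (Fin 2)) (Perm (Fin (m - 2)))))
  have hφ : ∀ r, φ r = e.permCongr ((1 : Perm (Fin 2)).sumCongr r) := fun _ => rfl
  have hφ' : ∀ r, φ' r = e'.permCongr ((1 : Perm (Fin 2)).sumCongr r) := fun _ => rfl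
  let Φ : Perm (Fin (m - 2)) × Perm (Fin (m - 2)) →* Perm (Fin m) × Perm (Fin m) := MonoidHom.prodMap φ φ'
  have hΦ : ∀ x, Φ x = (φ x.1, φ' x.2) := fun _ => rfl
  have hΦinj : Function.Injective Φ := by
    intro x y hxy
    have h1 := congrArg Prod.fst hxy
    have h2 := congrArg Prod.snd hxy
    rw [hΦ, hΦ] at h1 h2
    change φ x.1 = φ y.1 at h1
    change φ' x.2 = φ' y.2 at h2
    rw [hφ, hφ] at h1
    rw [hφ', hφ'] at h2
    have h1' := e.permCongr.injective h1
    have h2' := e'.permCongr.injective h2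
    refine Prod.ext (Equiv.ext fun i => ?_) (Equiv.ext fun i => ?_)
    · simpa using Equiv.congr_fun h1' (Sum.inr i)
    · simpa using Equiv.congr_fun h2' (Sum.inr i)
  -- `u` is fixed by `N`
  have hfix : ∀ n ∈ Φ.range, ρ n ⟨X (a, b) * X (c, d), hu⟩ = ⟨X (a, b) * X (c, d), hu⟩ := by
    rintro _ ⟨x, rfl⟩
    apply Subtype.ext
    rw [hρ, hΦ, Submodule.coe_mk, map_mul, rename_X, rename_X]
    show X (φ x.1 a, φ' x.2 b) * X (φ x.1 c, φ' x.2 d) = X (a, b) * X (c, d)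
    rw [hφ, hφ', (he x.1).1, (he x.1).2, (he' x.2).1, (he' x.2).2]
  -- `χ = χ^λ ⊠ χ^μ` is irreducible and `∑_N χ = (∑_{𝔖_{m-2}} χ^λ ∘ φ)(∑_{𝔖_{m-2}} χ^μ ∘ φ') = 0`
  have hχ : IsIrrChar (Perm (Fin m) × Perm (Fin m))
      (fun t : Perm (Fin m) × Perm (Fin m) => spechtCharacter ℂ la t.1 * spechtCharacter ℂ mu t.2) :=
    (isIrrChar_spechtCharacter la).boxProd (isIrrChar_spechtCharacter mu)
  have h0 : ∑ n : ↥Φ.range,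
      (fun t : Perm (Fin m) × Perm (Fin m) => spechtCharacter ℂ la t.1 * spechtCharacter ℂ mu t.2) n = 0 := by
    have hinj : Function.Injective
        (fun x : Perm (Fin (m - 2)) × Perm (Fin (m - 2)) => (⟨Φ x, ⟨x, rfl⟩⟩ : ↥Φ.range)) :=
      fun x y hxy => hΦinj (congrArg Subtype.val hxy)
    have hsurj : Function.Surjective
        (fun x : Perm (Fin (m - 2)) × Perm (Fin (m - 2)) => (⟨Φ x, ⟨x, rfl⟩⟩ : ↥Φ.range)) := by
      rintro ⟨_, x, rfl⟩
      exact ⟨x, rfl⟩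
    have hsum : ∑ n : ↥Φ.range,
        (fun t : Perm (Fin m) × Perm (Fin m) => spechtCharacter ℂ la t.1 * spechtCharacter ℂ mu t.2) n =
        ∑ x : Perm (Fin (m - 2)) × Perm (Fin (m - 2)),
          (fun t : Perm (Fin m) × Perm (Fin m) => spechtCharacter ℂ la t.1 * spechtCharacter ℂ mu t.2) (Φ x) :=
      (Fintype.sum_bijective _ ⟨hinj, hsurj⟩
        (fun x => (fun t : Perm (Fin m) × Perm (Fin m) =>
          spechtCharacter ℂ la t.1 * spechtCharacter ℂ mu t.2) (Φ x))
        (fun n : ↥Φ.range => (fun t : Perm (Fin m) × Perm (Fin m) =>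
          spechtCharacter ℂ la t.1 * spechtCharacter ℂ mu t.2) n)
        (fun _ => rfl)).symm
    rw [hsum]
    simp only [hΦ, hφ, hφ', Fintype.sum_prod_type]
    rw [← Finset.sum_mul_sum]
    rcases not_and_or.1 h with hla | hmu
    · have hz : ∑ r : Perm (Fin (m - 2)), spechtCharacter ℂ la (e.permCongr ((1 : Perm (Fin 2)).sumCongr r)) = 0 :=
        not_not.1 fun hne => hla (le_getD_add_two_of_sum_ne_zero e la hne)
      rw [hz, zero_mul]
    · have hz : ∑ r : Perm (Fin (m - 2)), spechtCharacter ℂ mu (e'.permCongr ((1 : Perm (Fin 2)).sumCongr r)) = 0 :=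
        not_not.1 fun hne => hmu (le_getD_add_two_of_sum_ne_zero e' mu hne)
      rw [hz, mul_zero]
  -- hence `P_χ u = 0`; read off the polynomial identity
  have hP := isotypicProj_eq_zero_of_sum_eq_zero ρ Φ.range hχ h0 hfix
  have hval := congrArg Subtype.val hP
  rw [isotypicProj_apply, Submodule.coe_sum] at hval
  simp only [Submodule.coe_smul, Submodule.coe_zero, hρ, Prod.fst_inv, Prod.snd_inv, Prod.fst_one,
    Prod.snd_one] at hval
  rw [sum_mul_smul_eq] at hval
  have hC : spechtCharacter ℂ la 1 * spechtCharacter ℂ mu 1 /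
      (Fintype.card (Perm (Fin m) × Perm (Fin m)) : ℂ) ≠ 0 :=
    div_ne_zero (mul_ne_zero (isIrrChar_spechtCharacter la).apply_one_ne_zero
      (isIrrChar_spechtCharacter mu).apply_one_ne_zero) (Nat.cast_ne_zero.2 Fintype.card_ne_zero)
  exact (smul_eq_zero.1 hval).resolve_left hC

/-- ★★ [I2] TYPE LIST.  For every quadric `v` and all `λ, μ ⊢ m` not both in `{(m), (m-1,1), (m-2,2), (m-2,1,1)}`,
`∑_{(g,h)} χ^λ(g) χ^μ(h) · (g,h)⁻¹ · v = 0`; i.e. `R_2` has only the sixteen types `λ ⊠ μ` with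
`λ, μ ∈ {(m), (m-1,1), (m-2,2), (m-2,1,1)}` (James–Liebeck 29.13 for the two-point stabiliser). [this file] -/
theorem sum_boxProd_smul_rename_eq_zero (hm : 2 ≤ m) {la mu : Nat.Partition m}
    (h : ¬ (m ≤ la.sortedParts.getD 0 0 + 2 ∧ m ≤ mu.sortedParts.getD 0 0 + 2))
    {v : MvPolynomial (Fin m × Fin m) ℂ} (hv : v.IsHomogeneous 2) :
    ∑ t : Perm (Fin m) × Perm (Fin m), (spechtCharacter ℂ la t.1 * spechtCharacter ℂ mu t.2) •
      rename (Equiv.prodCongr t.1⁻¹ t.2⁻¹) v = 0 := by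
  -- the symmetriser as a linear map; it kills the spanning monomials (★), hence their span `∋ v`
  set L : MvPolynomial (Fin m × Fin m) ℂ →ₗ[ℂ] MvPolynomial (Fin m × Fin m) ℂ :=
    ∑ t : Perm (Fin m) × Perm (Fin m), (spechtCharacter ℂ la t.1 * spechtCharacter ℂ mu t.2) •
      (rename (Equiv.prodCongr t.1⁻¹ t.2⁻¹)).toLinearMap with hLdef
  have hL : ∀ w, L w = ∑ t : Perm (Fin m) × Perm (Fin m), (spechtCharacter ℂ la t.1 * spechtCharacter ℂ mu t.2) •
      rename (Equiv.prodCongr t.1⁻¹ t.2⁻¹) w := fun w => by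
    simp only [hLdef, LinearMap.sum_apply, LinearMap.smul_apply, AlgHom.toLinearMap_apply]
  rw [← hL, ← LinearMap.mem_ker]
  refine (Submodule.span_le.2 ?_) (mem_span_X_mul_X hv)
  rintro _ ⟨pq, rfl⟩
  rw [SetLike.mem_coe, LinearMap.mem_ker, hL]
  exact sum_boxProd_smul_rename_X_mul_X_eq_zero hm h pq.1 pq.2

end Summit.ValiantsHypothesis.ValiantsHypothesis.Theorems.EquivariantDialLayersQuadricTypes
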